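import Summits.QuantumFields.BalabanUV.T4Continuum.Spine.NE1p.DressedSmallFieldOnCoresSlot

/-!
# T⁴ programme, spine estimate NE1′ (node O3b/H2) — (B3)'s LETTER BUDGET SPLITS INTO A PER-TERM AMPLITUDE AND A TABLE-BLIND
# COUNT; for terms indexed by COVERING FAMILIES of scale-`k` domains the count IS the (2.27)∕(2.29) step of [Balaban1988RGII]'s
# resummation — the b13 sub-cell's PROVED `B13FamilySum.ineq229_locDomainSys` and the (2.11)-geometry's `Ineq227` BY NAME

Cell `pub-balaban`, sub-cell `t4`, BINDER-OWNERS row NE1′; owner lineage t4-ne1p-p1 (PROVER seat P1, «RG-trajectory comparison …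
μ-uniformity through the printed small-field bounds»), generation 29; ADDITIVE — imports the owner's N0r
`Spine/NE1p/DressedSmallFieldOnCoresSlot` (p228506) ONLY (→ N0q `DressedSmallFieldOnCoresMass` p226475 → N0p p224732; the b13
sub-cell's `Literature/…/Balaban1983to89/B13FamilySum` — `coveringFamilies`, `Ineq126`, `VolBound`, `Ineq227`, `Ineq229`,
`ineq229_locDomainSys` — lies in its import cone through `B13Resummation`); THEOREMS ONLY (0 def, 0 `def … : Prop`, 0 cite); nothing
of N0p ∕ N0q ∕ N0r ∕ row NE5's ∕ the substrate's ∕ b13's modules is restated — their declarations are used BY NAME.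

WHY THIS FILE (road P1's own question: through WHICH letter does the source `μ` ∕ the dressed table radius enter the small-field
bracket's (B3)?).  After N0q the bracket's «(B3) (2.38)-TYPE binder, UNPRINTED for other tables, also holding the size half» (wall
v1.7, T4-DAG v42; annotation (ii) of C-t4r2-363) reads as ONE scalar inequality per polymer `Z` of the step geometry:
`hM3 : Σ_{i ∈ terms Z} λ_i(univ)·(wB_i·N₀_i·e^{bq_i})·(π∕(mq_i∕2))^{dim α_i∕2}·e^{N₁,i·R₀} ≤ (A₀ + ϱA₁)·e^{−R d(Z)}`, `R₀` the dressed
table radius (`‖h₀‖ + ϱ‖w‖` along the table pencil, `‖h₀‖ + μ₁‖v‖` along the source pencil).  Such a sum is AMPLITUDE × COUNT: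
* §1 `sum_le_amp_mul_count` [arith]: if every term's letter product is `≤ amp·maj Z i` and `Σ_{i ∈ terms Z} maj Z i ≤ K`, the letter
  sum is `≤ amp·K`.  The majorants `maj` need not see the table: the COUNT is then TABLE-BLIND — the same number for the dressed and
  the undressed run, for every source `μ` in the window and every cutoff — and the dressed radius `R₀` enters ONLY the per-term
  AMPLITUDE clause.  This is where μ-UNIFORMITY of (B3) is decided (R-t4r2-Q2: constants before `∀ μ`, `∀ K`).
* §2 THE COUNT OVER COVERING FAMILIES (kernel): for terms indexed by families `𝐃` of scale-`k` domains covering a footprint `Y₀`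
  exactly (the tree's `B13FamilySum.coveringFamilies S cubesK Y₀` — the index set of (2.29)) with the table-blind majorant
  `maj 𝐃 := Π_{Y∈𝐃} α₆e^{−δκ d_k(Y)}·e^{−R(d_k(Y)+c)}`: `prod_family_le` — the (2.27)-form `dZ + c ≤ Σ_{Y∈𝐃}(d_k(Y)+c)` makes
  the second factors multiply to `≤ e^{−R(dZ+c)}`; `count_coveringFamilies` — with (2.29) `Σ_𝐃 Π_{Y∈𝐃} α₆e^{−δκ d_k(Y)} ≤ 1` the
  count over ANY sub-collection of covering families is `≤ e^{−R(dZ+c)}`; `count_coveringFamilies_locDomainSys` — (2.29) SUPPLIED BY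
  NAME from `B13FamilySum.ineq229_locDomainSys` ((1.26) `Ineq126` + the additive volume bound `VolBound` on the scale-`k` catalogue,
  print's order of choice «κ sufficiently large» `κ₀ + 1 ≤ δκ`, «α₆ sufficiently small» `e K₀ c₁ α₆ ≤ 1`); `c₁_pos_of_geometry`;
  **`count_coveringFamilies_geometry`** — everything supplied by a (2.11)-geometry `Gk : B13Resummation.Geometry Dk CubeK` ONE SCALE
  DOWN (`Gk.ineq126`, `Gk.volBound`, `Gk.ineq227` with print's `5`), the `locE` polymer `Z` of the step geometry read as the scale-`k`
  domain `foot Z` with `d(Z) ≤ d_k(foot Z)` (`hmono`): `Σ_{𝐃 ∈ terms} Π_{Y∈𝐃} α₆e^{−δκ d_k Y}·e^{−R(d_k Y+5)} ≤ e^{−R d(Z)}`.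
* §3 (kernel) N0r's ENDs re-fired ONCE BY NAME with `hM3 ⇐ hAmp ∧ hCount` (abstract majorants `maj : D.Dom → ι → ℝ`):
  `attachedPart_locE_le_of_coresAt_pencil_count` ∕ `muPart_locE_le_of_coresAt_pencil_count` (core families with term-dependent
  polymer families, table pencil `h₀ + s•w` ∕ source pencil `h₀ + s•v`) and §3b `attachedPart_locE_le_of_actOfLetters_count` (the
  substrate's slot `actOfLetters ℓ`, term index `Pol × J`, `hact` by `rfl` as in N0r §3).  Every other binder VERBATIM N0r's.
* §4 (kernel) **`attachedPart_locE_le_of_coresAt_pencil_families`** — §3 at the term index `Finset Dk.Dom` (one core per Mayer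
  subfamily `𝐃`), `hCount` DISCHARGED by §2 from `Gk`; displayed of (B3): `hterms : terms Z ⊆ coveringFamilies univ Gk.cubes
  (Gk.cubes (foot Z))` (the terms of `Z` ARE covering families — an identification, (B1b) READING) and the per-family AMPLITUDE
  `hAmp : letters(Z, 𝐃) ≤ (A₀ + ϱA₁)·Π_{Y∈𝐃} α₆e^{−δκ d_k(Y)}·e^{−R(d_k(Y)+5)}`, plus the two numeric clauses and `hmono`.

PRINTED LOCI (TYPE∕CONTEXT only — the audited manuscript [Balaban1988RGII] = CMP 116 (1988) 1–22, renders
`b2b-balaban-ref1/pages/1988-cmp116-rg-II-cluster/…-p015∕p016∕p017∕p018∕p019-x2.png` read as images this generation; nothing below is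
used as a fact about Bałaban's densities).  p. 17: «To get a bound for H(Z) we have to perform the resummation of the terms (2.14) over
𝐃, P and Z₀. We do it in the following order. For a fixed Y₀ we sum over all 𝐃 satisfying (2.2). Next, we sum over Y₀, P determining
a fixed Z₀. Further, for a fixed Z′₀, we sum over all possible Z₀ determining this fixed Z′₀. Finally we sum over all Z′₀ ⊂ Z.»;
(2.26) p. 17 — the per-term bound with «Π_{Y∈𝐃} 2E₀ε₁C₁α₄⁻¹M^q exp C₂κ₁ exp(−(1−3δ)κd_k(Y))» (the τ-radii (2.18) p. 16
«1∕|τ(Y)| = E₀ε₁C₁α₄⁻¹M^q exp C₂κ₁ exp(−(1−3δ)κd_k(Y))»); p. 18: «We extract the expression α₆exp(−δκd_k(Y)) from each factor in it»,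
(2.27) «Σ_{Y∈𝐃}(d_k(Y)+5) ≥ d_k(Y₀)+5», «Assuming 2E₀ε₁C₁α₄⁻¹α₆⁻¹M^q exp C₂κ₁ exp 5κ ≤ 1, we have» (2.28), (2.29) «Σ_𝐃 Π_{Y∈𝐃}
α₆exp(−δκd_k(Y)) ≤ 1»; (2.36) p. 19 «2d_k(Z_i) ≥ Ld_{k+1}(Z′_i)» (the tree's REPAIRED transfer, GAPS G-B13-09R: factor `L∕a_L > 1` for
`L ≥ 7`, `B13.lean` Part F ∕ `TreeLength.scaleTransfer_treeLen` — `hmono` asks only the factor `1`).  THIS FILE = the FIRST of print's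
four resummation steps (the 𝐃-sum at fixed Y₀, (2.27)–(2.29)) in kernel BY NAME on the cell's format; the Y₀∕P-, Z₀- and Z′₀-sums
((2.31)–(2.35), (2.36)–(2.37), (2.39)–(2.41)) are NOT composed here (tree pieces: `B13.lean` `indicator_le_exp_222` ∕ `prod_bound_228` ∕
`case_empty_233` ∕ `sum_powerset_le_exp_234` ∕ Part F, `B13Ineq232TreeLength.ineq232_treeLen`, `TreeLength`, `B13Resummation`'s KP
bridge) — in §4 they are the sub-case «Y₀ = Z₀ = Z» (the family covers the whole footprint), in §3 they live in `maj`∕`hCount`.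

WHAT THIS DOES TO THE WALL (owner's reading; nothing re-labelled here).  In the letter currency (B3) = (B3-count) ∧ (B3-amp):
(B3-count) is TABLE-BLIND — μ-FREE and cutoff-free BY CONSTRUCTION — of printed KIND ((2.27)∕(2.29)∕(2.31)–(2.37)), and for the
𝐃-step PROVED in the tree on the cell's scale-`k` (2.11)-geometry (§2, b13's `B13FamilySum` by name); (B3-amp) is ONE per-term letter
inequality, where BOTH the «UNPRINTED for other tables» residue AND the «size half» (`e^{N₁R₀}`, annotation (ii)) sit: for (2.14)-cores
its letters are rows NE2∕NE3's Gaussian data (`N₀`, `mq`, `bq`), the contour letters `λ(univ)·wB` (crew W34's located per-cube ∕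
per-polymer factors) and `e^{N₁R₀}` — print's p. 18 clause «2E₀ε₁C₁α₄⁻¹α₆⁻¹M^q exp C₂κ₁ exp 5κ ≤ 1» (= `B13.Consts.R15` KIND) read with
the τ-radii (2.18) chosen at the DRESSED table level, i.e. at `C₃(E₀ + D₀)` (wall v1.6∕v1.7 wording) — ARITHMETIC on displayed letters,
NOT asserted.  NOTHING of (B3) is discharged on Bałaban's densities; `hterms` (terms = covering families) and `foot`∕`emb` are
(B1b)-READING identifications; 0 binders instantiated on Bałaban's (2.14) data; wall v1.7 does NOT move; NE1′ NOT printed, NOT proved;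
0∕9; count 9 unchanged.

HONEST FRAMING.  By-name compositions over SHAPES, the b13 sub-cell's PROVED (2.29) (`B13FamilySum`, [folklore] combinatorics of a
finite catalogue under the displayed (1.26)∕volume hypotheses of `Geometry`) and N0r's ENDs; the cores are the cell's typed FORMAT of
(2.14) with letters, not Bałaban's functions; the scale-`k` geometry `Gk` is a HYPOTHESIS structure (an instance on pv22's torus is
the cell's, N0o∕S24 KIND, not constructed here).  ABSOLUTE RULE honoured: the quotations above are LOCI of the audited manuscript,
TYPE∕CONTEXT only, never hypothesis-free facts; nothing internally minted is cited; [folklore]∕[arith] tags on kernel lemmas only.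
Rung (B)+1 on ONE finite T⁴ — NOT infinite volume, NOT a mass gap, NOT OS on ℝ⁴, NOT Clay.  HONEST DEPENDENCY: continuum YM on T⁴ ⇐ BetaPertH ∧
nine spine estimates (0/9 proved); BetaPertH ⇐ (D1) ∧ (D4) ∧ CAP+tail; G-an2-4 gates asym, D1 and NE2/3/4. -/
noncomputable section

namespace Summit.QuantumFields.BalabanUV.T4Continuum.NE1p.DressedSmallFieldFamilyCount

open Metric Set Complex MeasureTheory
open scoped BigOperators
open Literature.MathematicalPhysics.QuantumFieldTheory.Balaban1983to89 (LocDomainSys)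
open Literature.MathematicalPhysics.QuantumFieldTheory.Balaban1983to89.T4OutputRate (Carriers)
open Literature.MathematicalPhysics.QuantumFieldTheory.Balaban1983to89.B13Resummation (locE Geometry)
open Literature.MathematicalPhysics.QuantumFieldTheory.Balaban1983to89.B13FamilySum (coveringFamilies Ineq126 VolBound
  Ineq227 Ineq229 mem_coveringFamilies ineq229_locDomainSys)
open Literature.MathematicalPhysics.QuantumFieldTheory.Balaban1983to89.T4InputCauchyRateSpecies (ballClass)
open Summit.QuantumFields.BalabanUV.T4Continuum.B13HistMeasurable (MeasPotFrame B13HistM)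
open Summit.QuantumFields.BalabanUV.T4Continuum.B13TermParamGaussianBi (BiCore)
open Summit.QuantumFields.BalabanUV.T4Continuum.SubstrateActivities (CoreLetters coreOf actOfLetters)
open Summit.QuantumFields.BalabanUV.T4Continuum.NE1p.DressedSmallFieldOnCoresSlot
  (attachedPart_locE_le_of_coresAt_pencil_mass muPart_locE_le_of_coresAt_pencil_mass
  attachedPart_locE_le_of_actOfLetters)

/-! ## §1 THE SPLIT: a (2.38)-shape letter sum is AMPLITUDE × COUNT -/

/-- **AMPLITUDE × COUNT** [arith]: if every term's letter product is at most `amp · maj` (`amp ≥ 0`) and the majorants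
`maj` of the terms sum to at most `K`, the letter sum is at most `amp · K`. -/
theorem sum_le_amp_mul_count {ι : Type*} {terms : Finset ι} {letters maj : ι → ℝ} {amp K : ℝ} (hamp : 0 ≤ amp)
    (hAmp : ∀ i ∈ terms, letters i ≤ amp * maj i) (hCount : ∑ i ∈ terms, maj i ≤ K) :
    ∑ i ∈ terms, letters i ≤ amp * K :=
  (Finset.sum_le_sum hAmp).trans (by rw [← Finset.mul_sum]; exact mul_le_mul_of_nonneg_left hCount hamp)

/-! ## §2 THE TABLE-BLIND COUNT OVER COVERING FAMILIES: (2.27) carries the decay, (2.29) bounds the number -/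

section Count

variable {DomK CubeK : Type*} [DecidableEq CubeK]

/-- **(2.27) CARRIES THE DECAY** [arith]: for a family `Df` with `dZ + c ≤ Σ_{Y∈Df} (d_k Y + c)` (the (2.27) form) and `R ≥ 0`,
the per-member factors `e^{−R (d_k Y + c)}` multiply to at most `e^{−R (dZ + c)}`:
`Π_{Y∈Df} (a_Y · e^{−R(d_k Y + c)}) ≤ e^{−R(dZ + c)} · Π_{Y∈Df} a_Y` for nonnegative `a`. -/
theorem prod_family_le {Df : Finset DomK} {dK a : DomK → ℝ} {R c dZ : ℝ} (hR : 0 ≤ R) (ha : ∀ Y ∈ Df, 0 ≤ a Y)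
    (h227 : dZ + c ≤ ∑ Y ∈ Df, (dK Y + c)) :
    ∏ Y ∈ Df, (a Y * Real.exp (-(R * (dK Y + c)))) ≤ Real.exp (-(R * (dZ + c))) * ∏ Y ∈ Df, a Y := by
  rw [Finset.prod_mul_distrib, mul_comm, ← Real.exp_sum]
  refine mul_le_mul_of_nonneg_right (Real.exp_le_exp.2 ?_) (Finset.prod_nonneg ha)
  rw [Finset.sum_neg_distrib, ← Finset.mul_sum, neg_le_neg_iff]
  exact mul_le_mul_of_nonneg_left h227 hR

/-- **THE COUNT OVER COVERING FAMILIES** (kernel; (2.27) p. 18 for the decay, (2.29) p. 18 for the number — both as DISPLAYED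
hypotheses here, see `count_coveringFamilies_locDomainSys` ∕ `_geometry` for (2.29) ∕ (2.27) supplied BY NAME): for a finite
catalogue `S` of scale-`k` domains with footprints `cubesK` and sizes `d_k`, a footprint `Y₀` with `dZ + c ≤ Σ_{Y∈Df}(d_k Y + c)`
for every family `Df ⊆ S` covering `Y₀` exactly, `Σ_Df Π_{Y∈Df} α₆ e^{−r d_k Y} ≤ 1`, and ANY sub-collection `terms` of those
families: `Σ_{Df ∈ terms} Π_{Y∈Df} (α₆ e^{−r d_k Y} · e^{−R(d_k Y + c)}) ≤ e^{−R (dZ + c)}`. [folklore] -/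
theorem count_coveringFamilies (S : Finset DomK) (cubesK : DomK → Finset CubeK) (dK : DomK → ℝ) (Y₀ : Finset CubeK)
    {α₆ r R c dZ : ℝ} (hα₆ : 0 ≤ α₆) (hR : 0 ≤ R)
    (h229 : ∑ Df ∈ coveringFamilies S cubesK Y₀, ∏ Y ∈ Df, α₆ * Real.exp (-(r * dK Y)) ≤ 1)
    (h227 : ∀ Df ∈ coveringFamilies S cubesK Y₀, dZ + c ≤ ∑ Y ∈ Df, (dK Y + c))
    {terms : Finset (Finset DomK)} (hterms : terms ⊆ coveringFamilies S cubesK Y₀) :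
    ∑ Df ∈ terms, ∏ Y ∈ Df, (α₆ * Real.exp (-(r * dK Y)) * Real.exp (-(R * (dK Y + c)))) ≤
      Real.exp (-(R * (dZ + c))) := by
  have hnn : ∀ Df : Finset DomK, ∀ Y ∈ Df, 0 ≤ α₆ * Real.exp (-(r * dK Y)) := fun _ _ _ => by positivity
  calc ∑ Df ∈ terms, ∏ Y ∈ Df, (α₆ * Real.exp (-(r * dK Y)) * Real.exp (-(R * (dK Y + c))))
      ≤ ∑ Df ∈ coveringFamilies S cubesK Y₀, ∏ Y ∈ Df, (α₆ * Real.exp (-(r * dK Y)) * Real.exp (-(R * (dK Y + c)))) :=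
        Finset.sum_le_sum_of_subset_of_nonneg hterms fun Df _ _ => Finset.prod_nonneg fun Y _ => by positivity
    _ ≤ ∑ Df ∈ coveringFamilies S cubesK Y₀, Real.exp (-(R * (dZ + c))) * ∏ Y ∈ Df, α₆ * Real.exp (-(r * dK Y)) :=
        Finset.sum_le_sum fun Df hDf => prod_family_le hR (hnn Df) (h227 Df hDf)
    _ ≤ Real.exp (-(R * (dZ + c))) * 1 := by
        rw [← Finset.mul_sum]; exact mul_le_mul_of_nonneg_left h229 (Real.exp_pos _).le
    _ = Real.exp (-(R * (dZ + c))) := mul_one _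

/-- **THE COUNT WITH (2.29) SUPPLIED BY NAME** (kernel; `B13FamilySum.ineq229_locDomainSys` — (2.29) PROVED in the tree from (1.26)
`Ineq126` and the additive volume bound `VolBound` on the scale-`k` catalogue `Df_k = univ`, with print's order of choice «κ
sufficiently large» `κ₀ + 1 ≤ δκ` and «α₆ sufficiently small» `e K₀ c₁ α₆ ≤ 1`): the covering-family count at rate `r = δκ`,
weakened to `e^{−R dZ}` for `R c ≥ 0`. [folklore] -/
theorem count_coveringFamilies_locDomainSys (Dk : LocDomainSys) (cubesK : Dk.Dom → Finset CubeK)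
    {κ₀ K₀ c₁ δ κ α₆ R c dZ : ℝ} (Y₀ : Finset CubeK) (hne : ∀ Y, (cubesK Y).Nonempty)
    (hvol : VolBound (Finset.univ : Finset Dk.Dom) cubesK Dk.dj c₁)
    (h126 : Ineq126 (Finset.univ : Finset Dk.Dom) cubesK Dk.dj κ₀ K₀) (hα₆ : 0 ≤ α₆) (hc₁ : 0 < c₁)
    (hκ : κ₀ + 1 ≤ δ * κ) (hsmall : Real.exp 1 * K₀ * c₁ * α₆ ≤ 1) (hR : 0 ≤ R) (hc : 0 ≤ c)
    (h227 : ∀ Df ∈ coveringFamilies Finset.univ cubesK Y₀, dZ + c ≤ ∑ Y ∈ Df, (Dk.dj Y + c))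
    {terms : Finset (Finset Dk.Dom)} (hterms : terms ⊆ coveringFamilies Finset.univ cubesK Y₀) :
    ∑ Df ∈ terms, ∏ Y ∈ Df, (α₆ * Real.exp (-(δ * κ * Dk.dj Y)) * Real.exp (-(R * (Dk.dj Y + c)))) ≤
      Real.exp (-(R * dZ)) := by
  have h229 : Ineq229 (Finset.univ : Finset Dk.Dom) cubesK Dk.dj α₆ (δ * κ) :=
    ineq229_locDomainSys Dk cubesK κ₀ K₀ c₁ δ κ α₆ 1 hne hvol h126 hα₆ zero_le_one hc₁ hκ (by linarith)
  refine (count_coveringFamilies Finset.univ cubesK Dk.dj Y₀ hα₆ hR (h229 Y₀) h227 hterms).trans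
    (Real.exp_le_exp.2 ?_)
  nlinarith

/-- The (2.11)-geometry's volume constant is positive: `1 ≤ #cubes X ≤ c₁ (1 + d X)` at any domain `X`. [folklore] -/
theorem c₁_pos_of_geometry {Dk : LocDomainSys} {CubeK' : Type} [DecidableEq CubeK'] (Gk : Geometry Dk CubeK') (X : Dk.Dom) :
    0 < Gk.c₁ := by
  have h1 : (1 : ℝ) ≤ ((Gk.cubes X).card : ℝ) := by exact_mod_cast (Gk.cubes_nonempty X).card_pos
  have h2 := Gk.volBound X (Finset.mem_univ X)
  by_contra hc
  nlinarith [Dk.dj_nonneg X, not_lt.1 hc]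

/-- **THE COUNT FROM THE CELL'S (2.11)-GEOMETRY ONE SCALE DOWN** (kernel; `Gk : Geometry Dk CubeK` supplies the footprints, (1.26)
`Gk.ineq126`, the volume bound `Gk.volBound` and (2.27) `Gk.ineq227` with print's constant `5`; the `locE` polymer `Z` is read as
the scale-`k` domain `foot Z` whose tree length dominates `d(Z)` — `hmono`, the scale-transfer (2.36) KIND `d_{k+1} ≤ d_k`): for ANY
sub-collection `terms` of the families covering `Gk.cubes (foot Z)`,
`Σ_{Df ∈ terms} Π_{Y∈Df} (α₆ e^{−δκ d_k Y} · e^{−R(d_k Y + 5)}) ≤ e^{−R d(Z)}`. [folklore] -/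
theorem count_coveringFamilies_geometry {D Dk : LocDomainSys} {CubeK : Type} [DecidableEq CubeK] (Gk : Geometry Dk CubeK)
    (foot : D.Dom → Dk.Dom) (hmono : ∀ Z, D.dj Z ≤ Dk.dj (foot Z)) {δ κ α₆ R : ℝ} (hα₆ : 0 ≤ α₆)
    (hκ : Gk.κ₀ + 1 ≤ δ * κ) (hsmall : Real.exp 1 * Gk.K₀ * Gk.c₁ * α₆ ≤ 1) (hR : 0 ≤ R) (Z : D.Dom)
    {terms : Finset (Finset Dk.Dom)} (hterms : terms ⊆ coveringFamilies Finset.univ Gk.cubes (Gk.cubes (foot Z))) :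
    ∑ Df ∈ terms, ∏ Y ∈ Df, (α₆ * Real.exp (-(δ * κ * Dk.dj Y)) * Real.exp (-(R * (Dk.dj Y + 5)))) ≤
      Real.exp (-(R * D.dj Z)) := by
  exact count_coveringFamilies_locDomainSys Dk Gk.cubes (dZ := D.dj Z) (Gk.cubes (foot Z)) Gk.cubes_nonempty Gk.volBound
    Gk.ineq126 hα₆ (c₁_pos_of_geometry Gk (foot Z)) hκ hsmall hR (by norm_num)
    (fun Df hDf => ((add_le_add_iff_right 5).2 (hmono Z)).trans (Gk.ineq227 (foot Z) Df hDf)) hterms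

end Count

/-! ## §3 THE ENDs WITH (B3) SPLIT: N0r's binder `hM3` ⇐ `hAmp` (per-term amplitude) ∧ `hCount` (table-blind count) -/

section Ends

variable {C : Carriers} {P : MeasPotFrame C} {Op : Type*} [NormedAddCommGroup Op] [NormedSpace ℂ Op] {ι : Type*}
  {𝒴 : ℕ → ι → Type*} {dom : ∀ k i, 𝒴 k i → C.Dom} {β : ℕ → ι → Type*} [∀ k i, MeasurableSpace (β k i)]
  {α : ℕ → ι → Type*} [∀ k i, NormedAddCommGroup (α k i)] [∀ k i, InnerProductSpace ℝ (α k i)]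
  [∀ k i, FiniteDimensional ℝ (α k i)] [∀ k i, MeasurableSpace (α k i)] [∀ k i, BorelSpace (α k i)]
variable (D : LocDomainSys) {Cube : Type} [DecidableEq Cube] (G : Geometry D Cube)

open Classical in
/-- **THE ATTACHED PART OF THE DRESSED SMALL-FIELD OUTPUT BUILT FROM CORES, ALONG `h₀ + s • w`, (B3) SPLIT INTO AMPLITUDE AND
COUNT** (kernel; N0r's `attachedPart_locE_le_of_coresAt_pencil_mass` ONCE BY NAME, its (2.38)-letter budget `hM3` supplied by §1 from
a per-term AMPLITUDE clause `hAmp` — each term's letter product `λ(univ)·(wB·N₀·e^{bq})·(π∕(mq∕2))^{dim∕2}·e^{N₁(‖h₀‖+ϱ‖w‖)}` is at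
most `(A₀ + ϱA₁)·maj Z i` (THE place where the dressed table radius `‖h₀‖ + ϱ‖w‖` enters) — and a TABLE-BLIND COUNT `hCount` —
`Σ_{i ∈ terms Z} maj Z i ≤ e^{−R d(Z)}` for any majorants `maj` not seeing the table).  Every other binder VERBATIM N0r's:
`hroom`; `hm`∕`hN`∕`hq`; `hO`∕`hH`; `hscale`; `hact`; `G`; the clauses; `hϱ`∕`hϱA`.  Conclusion:
`‖E[act 1](X₀) − E[act 0](X₀)‖ ≤ 4·(e ν c₁ K₀²)·A₁·e^{−r₁ d(X₀)}`. [folklore] -/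
theorem attachedPart_locE_le_of_coresAt_pencil_count {W : Set (ℕ → ℝ)} {ctr : ℕ → (ℕ → ℝ) → C.BgB → Op × B13HistM P}
    {ROp RHist R' : ℕ → ℝ} (𝔊 : ∀ k i, C.Dom → BiCore P (dom k i) Op (β k i) (α k i)) {mq bq N₀ : ℕ → ι → C.Dom → ℝ}
    (hroom : ∀ k, ROp k < R' k)
    (hm : ∀ k, ∀ g ∈ W, ∀ (U : C.BgB) (X : C.Dom), C.scale X = k → ∀ i, 0 < mq k i X)
    (hN : ∀ k, ∀ g ∈ W, ∀ (U : C.BgB) (X : C.Dom), C.scale X = k → ∀ i,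
      (∀ o ∈ ball (ctr k g U).1 (R' k), AEStronglyMeasurable ((𝔊 k i X).N o) (𝔊 k i X).lam) ∧
      (∀ p, DifferentiableOn ℂ (fun o => (𝔊 k i X).N o p) (ball (ctr k g U).1 (R' k))) ∧
      (∀ o ∈ ball (ctr k g U).1 (R' k), ∀ p, ‖(𝔊 k i X).N o p‖ ≤ N₀ k i X))
    (hq : ∀ k, ∀ g ∈ W, ∀ (U : C.BgB) (X : C.Dom), C.scale X = k → ∀ i,
      (∀ o ∈ ball (ctr k g U).1 (R' k),
        AEStronglyMeasurable (Function.uncurry ((𝔊 k i X).q o)) ((𝔊 k i X).lam.prod volume)) ∧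
      (∀ p v, DifferentiableOn ℂ (fun o => (𝔊 k i X).q o p v) (ball (ctr k g U).1 (R' k))) ∧
      (∀ o ∈ ball (ctr k g U).1 (R' k), ∀ p v, mq k i X * ‖v‖ ^ 2 - bq k i X ≤ ((𝔊 k i X).q o p v).re))
    {k : ℕ} {g : ℕ → ℝ} (hg : g ∈ W) {U : C.BgB} {o : Op} {h₀ w : B13HistM P} {ϱ : ℝ}
    (hO : ‖o - (ctr k g U).1‖ ≤ ROp k) (hH : ‖h₀ - (ctr k g U).2‖ + ϱ * ‖w‖ ≤ RHist k)
    {emb : D.Dom → C.Dom} (hscale : ∀ Z, C.scale (emb Z) = k) {terms : D.Dom → Finset ι} {act : ℂ → D.Dom → ℂ}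
    (hact : ∀ s ∈ ball (0 : ℂ) ϱ, ∀ Z, act s Z = ∑ i ∈ terms Z, (𝔊 k i (emb Z)).termAt o (h₀ + s • w))
    {A₀ A₁ R r₁ b₅ : ℝ} {X₀ : D.Dom} (hA₀ : 0 ≤ A₀) (hA₁ : 0 ≤ A₁) (hr₁ : 0 ≤ r₁) (hb : r₁ * 5 ≤ b₅)
    (hrate : r₁ + 2 * G.κ₀ + 2 ≤ R) (hsmall : (A₀ + ϱ * A₁) * Real.exp (b₅ + 1) * G.K₀ * G.ν * G.c₁ ≤ 1)
    (maj : D.Dom → ι → ℝ)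
    (hAmp : ∀ Z, G.cubes Z ⊆ G.cubes X₀ → ∀ i ∈ terms Z,
      (𝔊 k i (emb Z)).lam.real univ * ((𝔊 k i (emb Z)).wB * N₀ k i (emb Z) * Real.exp (bq k i (emb Z))) *
          (Real.pi / (mq k i (emb Z) / 2)) ^ (Module.finrank ℝ (α k i) / 2 : ℝ) *
        Real.exp ((𝔊 k i (emb Z)).N₁ * (‖h₀‖ + ϱ * ‖w‖)) ≤ (A₀ + ϱ * A₁) * maj Z i)
    (hCount : ∀ Z, G.cubes Z ⊆ G.cubes X₀ → ∑ i ∈ terms Z, maj Z i ≤ Real.exp (-(R * D.dj Z)))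
    (hϱ : 2 ≤ ϱ) (hϱA : A₀ ≤ ϱ * A₁) :
    ‖locE G.ι G.cubes (act 1) (G.cubes X₀) - locE G.ι G.cubes (act 0) (G.cubes X₀)‖ ≤
      4 * (Real.exp 1 * G.ν * G.c₁ * G.K₀ ^ 2) * A₁ * Real.exp (-(r₁ * D.dj X₀)) :=
  attachedPart_locE_le_of_coresAt_pencil_mass D G 𝔊 hroom hm hN hq hg hO hH hscale hact hA₀ hA₁ hr₁ hb hrate hsmall
    (fun Z hZ => sum_le_amp_mul_count (add_nonneg hA₀ (mul_nonneg (by linarith) hA₁)) (hAmp Z hZ) (hCount Z hZ)) hϱ hϱA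

open Classical in
/-- **THE μ-PART (SOURCE PENCIL `h₀ + s • v`, `‖s‖ < μ₁`) BUILT FROM CORES, (B3) SPLIT INTO AMPLITUDE AND COUNT** (kernel; N0r's
`muPart_locE_le_of_coresAt_pencil_mass` ONCE BY NAME, `hM3 ⇐ hAmp ∧ hCount` by §1 at the amplitude `A` and the table radius
`‖h₀‖ + μ₁‖v‖` — the source window's radius enters ONLY `hAmp`).  For `0 < μ₀ < μ₁`, `‖sμ‖ ≤ μ₀`:
`‖E[act sμ](X₀) − E[act 0](X₀)‖ ≤ (e ν c₁ K₀²·A·e^{−r₁ d(X₀)})·μ₀∕(μ₁ − μ₀)`. [folklore] -/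
theorem muPart_locE_le_of_coresAt_pencil_count {W : Set (ℕ → ℝ)} {ctr : ℕ → (ℕ → ℝ) → C.BgB → Op × B13HistM P}
    {ROp RHist R' : ℕ → ℝ} (𝔊 : ∀ k i, C.Dom → BiCore P (dom k i) Op (β k i) (α k i)) {mq bq N₀ : ℕ → ι → C.Dom → ℝ}
    (hroom : ∀ k, ROp k < R' k)
    (hm : ∀ k, ∀ g ∈ W, ∀ (U : C.BgB) (X : C.Dom), C.scale X = k → ∀ i, 0 < mq k i X)
    (hN : ∀ k, ∀ g ∈ W, ∀ (U : C.BgB) (X : C.Dom), C.scale X = k → ∀ i,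
      (∀ o ∈ ball (ctr k g U).1 (R' k), AEStronglyMeasurable ((𝔊 k i X).N o) (𝔊 k i X).lam) ∧
      (∀ p, DifferentiableOn ℂ (fun o => (𝔊 k i X).N o p) (ball (ctr k g U).1 (R' k))) ∧
      (∀ o ∈ ball (ctr k g U).1 (R' k), ∀ p, ‖(𝔊 k i X).N o p‖ ≤ N₀ k i X))
    (hq : ∀ k, ∀ g ∈ W, ∀ (U : C.BgB) (X : C.Dom), C.scale X = k → ∀ i,
      (∀ o ∈ ball (ctr k g U).1 (R' k),
        AEStronglyMeasurable (Function.uncurry ((𝔊 k i X).q o)) ((𝔊 k i X).lam.prod volume)) ∧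
      (∀ p v, DifferentiableOn ℂ (fun o => (𝔊 k i X).q o p v) (ball (ctr k g U).1 (R' k))) ∧
      (∀ o ∈ ball (ctr k g U).1 (R' k), ∀ p v, mq k i X * ‖v‖ ^ 2 - bq k i X ≤ ((𝔊 k i X).q o p v).re))
    {k : ℕ} {g : ℕ → ℝ} (hg : g ∈ W) {U : C.BgB} {o : Op} {h₀ v : B13HistM P} {μ₁ : ℝ}
    (hO : ‖o - (ctr k g U).1‖ ≤ ROp k) (hH : ‖h₀ - (ctr k g U).2‖ + μ₁ * ‖v‖ ≤ RHist k)
    {emb : D.Dom → C.Dom} (hscale : ∀ Z, C.scale (emb Z) = k) {terms : D.Dom → Finset ι} {act : ℂ → D.Dom → ℂ}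
    (hact : ∀ s ∈ ball (0 : ℂ) μ₁, ∀ Z, act s Z = ∑ i ∈ terms Z, (𝔊 k i (emb Z)).termAt o (h₀ + s • v))
    {A R r₁ b₅ μ₀ : ℝ} {X₀ : D.Dom} {sμ : ℂ} (hA : 0 ≤ A) (hr₁ : 0 ≤ r₁) (hb : r₁ * 5 ≤ b₅)
    (hrate : r₁ + 2 * G.κ₀ + 2 ≤ R) (hsmall : A * Real.exp (b₅ + 1) * G.K₀ * G.ν * G.c₁ ≤ 1)
    (maj : D.Dom → ι → ℝ)
    (hAmp : ∀ Z, G.cubes Z ⊆ G.cubes X₀ → ∀ i ∈ terms Z,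
      (𝔊 k i (emb Z)).lam.real univ * ((𝔊 k i (emb Z)).wB * N₀ k i (emb Z) * Real.exp (bq k i (emb Z))) *
          (Real.pi / (mq k i (emb Z) / 2)) ^ (Module.finrank ℝ (α k i) / 2 : ℝ) *
        Real.exp ((𝔊 k i (emb Z)).N₁ * (‖h₀‖ + μ₁ * ‖v‖)) ≤ A * maj Z i)
    (hCount : ∀ Z, G.cubes Z ⊆ G.cubes X₀ → ∑ i ∈ terms Z, maj Z i ≤ Real.exp (-(R * D.dj Z)))
    (h0 : 0 < μ₀) (h01 : μ₀ < μ₁) (hμ : ‖sμ‖ ≤ μ₀) :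
    ‖locE G.ι G.cubes (act sμ) (G.cubes X₀) - locE G.ι G.cubes (act 0) (G.cubes X₀)‖ ≤
      Real.exp 1 * G.ν * G.c₁ * G.K₀ ^ 2 * A * Real.exp (-(r₁ * D.dj X₀)) * (μ₀ / (μ₁ - μ₀)) :=
  muPart_locE_le_of_coresAt_pencil_mass D G 𝔊 hroom hm hN hq hg hO hH hscale hact hA hr₁ hb hrate hsmall
    (fun Z hZ => sum_le_amp_mul_count hA (hAmp Z hZ) (hCount Z hZ)) h0 h01 hμ

end Ends

/-! ## §3b THE SAME AT THE SUBSTRATE'S SLOT `actOfLetters ℓ` (term index `Pol × J`; `hact` by `rfl` as in N0r §3) -/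

section Slot

variable {C : Carriers} (P : MeasPotFrame C) (Op : Type*) [NormedAddCommGroup Op] [NormedSpace ℂ Op] {Pol J : Type*}
  (𝒴 : Pol → J → Type) [∀ Z j, Fintype (𝒴 Z j)] (dom : ∀ Z j, 𝒴 Z j → C.Dom)
  (Jc : Pol → J → Type) [∀ Z j, Fintype (Jc Z j)]
  (V : Pol → J → Type) [∀ Z j, NormedAddCommGroup (V Z j)] [∀ Z j, InnerProductSpace ℝ (V Z j)]
  [∀ Z j, MeasurableSpace (V Z j)] [∀ Z j, BorelSpace (V Z j)] [∀ Z j, FiniteDimensional ℝ (V Z j)]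
variable (D : LocDomainSys) {Cube : Type} [DecidableEq Cube] (G : Geometry D Cube)

open Classical in
/-- **THE ATTACHED PART OF THE DRESSED SMALL-FIELD OUTPUT OF THE SUBSTRATE'S SLOT ACTIVITIES, (B3) SPLIT INTO AMPLITUDE AND COUNT**
(kernel; N0r's `attachedPart_locE_le_of_actOfLetters` ONCE BY NAME with `hM3 ⇐ hAmp ∧ hCount` by §1: the substrate's letters
`(coreOf ℓ Z j).lam.real univ`, `.wB`, `.N₁`, the Gaussian letters `N₀`∕`mq`∕`bq` and the flat dimension enter ONLY the per-term
amplitude clause `hAmp` against table-blind majorants `maj Z p`; the count `hCount` is μ-free).  Binders otherwise VERBATIM N0r §3's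
((B1b)'s residue `terms`∕`emb`∕`hscale` displayed as there).  Conclusion: `‖E[Σ actOfLetters … (h₀ + w)](X₀) − E[Σ actOfLetters …
h₀](X₀)‖ ≤ 4·(e ν c₁ K₀²)·A₁·e^{−r₁ d(X₀)}`. [folklore] -/
theorem attachedPart_locE_le_of_actOfLetters_count {W : Set (ℕ → ℝ)} {ctr : ℕ → (ℕ → ℝ) → C.BgB → Op × B13HistM P}
    {ROp RHist R' : ℕ → ℝ} (ℓ : ∀ Z j, CoreLetters P Op 𝒴 dom Jc V Z j) {mq bq N₀ : ℕ → Pol × J → C.Dom → ℝ}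
    (hroom : ∀ k, ROp k < R' k)
    (hm : ∀ k, ∀ g ∈ W, ∀ (U : C.BgB) (X : C.Dom), C.scale X = k → ∀ p, 0 < mq k p X)
    (hN : ∀ k, ∀ g ∈ W, ∀ (U : C.BgB) (X : C.Dom), C.scale X = k → ∀ p : Pol × J,
      (∀ o ∈ ball (ctr k g U).1 (R' k),
        AEStronglyMeasurable ((ℓ p.1 p.2).N o) (coreOf P Op 𝒴 dom Jc V ℓ p.1 p.2).lam) ∧
      (∀ a, DifferentiableOn ℂ (fun o => (ℓ p.1 p.2).N o a) (ball (ctr k g U).1 (R' k))) ∧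
      (∀ o ∈ ball (ctr k g U).1 (R' k), ∀ a, ‖(ℓ p.1 p.2).N o a‖ ≤ N₀ k p X))
    (hq : ∀ k, ∀ g ∈ W, ∀ (U : C.BgB) (X : C.Dom), C.scale X = k → ∀ p : Pol × J,
      (∀ o ∈ ball (ctr k g U).1 (R' k),
        AEStronglyMeasurable (Function.uncurry ((ℓ p.1 p.2).q o))
          ((coreOf P Op 𝒴 dom Jc V ℓ p.1 p.2).lam.prod volume)) ∧
      (∀ a v, DifferentiableOn ℂ (fun o => (ℓ p.1 p.2).q o a v) (ball (ctr k g U).1 (R' k))) ∧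
      (∀ o ∈ ball (ctr k g U).1 (R' k), ∀ a v, mq k p X * ‖v‖ ^ 2 - bq k p X ≤ ((ℓ p.1 p.2).q o a v).re))
    {k : ℕ} {g : ℕ → ℝ} (hg : g ∈ W) {U : C.BgB} {o : Op} {h₀ w : B13HistM P} {ϱ : ℝ}
    (hO : ‖o - (ctr k g U).1‖ ≤ ROp k) (hH : ‖h₀ - (ctr k g U).2‖ + ϱ * ‖w‖ ≤ RHist k)
    {emb : D.Dom → C.Dom} (hscale : ∀ Z, C.scale (emb Z) = k) (terms : D.Dom → Finset (Pol × J))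
    {A₀ A₁ R r₁ b₅ : ℝ} {X₀ : D.Dom} (hA₀ : 0 ≤ A₀) (hA₁ : 0 ≤ A₁) (hr₁ : 0 ≤ r₁) (hb : r₁ * 5 ≤ b₅)
    (hrate : r₁ + 2 * G.κ₀ + 2 ≤ R) (hsmall : (A₀ + ϱ * A₁) * Real.exp (b₅ + 1) * G.K₀ * G.ν * G.c₁ ≤ 1)
    (maj : D.Dom → Pol × J → ℝ)
    (hAmp : ∀ Z, G.cubes Z ⊆ G.cubes X₀ → ∀ p ∈ terms Z,
      (coreOf P Op 𝒴 dom Jc V ℓ p.1 p.2).lam.real univ *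
          ((coreOf P Op 𝒴 dom Jc V ℓ p.1 p.2).wB * N₀ k p (emb Z) * Real.exp (bq k p (emb Z))) *
          (Real.pi / (mq k p (emb Z) / 2)) ^ (Module.finrank ℝ (V p.1 p.2) / 2 : ℝ) *
        Real.exp ((coreOf P Op 𝒴 dom Jc V ℓ p.1 p.2).N₁ * (‖h₀‖ + ϱ * ‖w‖)) ≤ (A₀ + ϱ * A₁) * maj Z p)
    (hCount : ∀ Z, G.cubes Z ⊆ G.cubes X₀ → ∑ p ∈ terms Z, maj Z p ≤ Real.exp (-(R * D.dj Z)))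
    (hϱ : 2 ≤ ϱ) (hϱA : A₀ ≤ ϱ * A₁) :
    ‖locE G.ι G.cubes (fun Z => ∑ p ∈ terms Z, actOfLetters P Op 𝒴 dom Jc V ℓ p.1 p.2 o (h₀ + w)) (G.cubes X₀) -
        locE G.ι G.cubes (fun Z => ∑ p ∈ terms Z, actOfLetters P Op 𝒴 dom Jc V ℓ p.1 p.2 o h₀) (G.cubes X₀)‖ ≤
      4 * (Real.exp 1 * G.ν * G.c₁ * G.K₀ ^ 2) * A₁ * Real.exp (-(r₁ * D.dj X₀)) :=
  attachedPart_locE_le_of_actOfLetters P Op 𝒴 dom Jc V D G ℓ hroom hm hN hq hg hO hH hscale terms hA₀ hA₁ hr₁ hb hrate hsmall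
    (fun Z hZ => sum_le_amp_mul_count (add_nonneg hA₀ (mul_nonneg (by linarith) hA₁)) (hAmp Z hZ) (hCount Z hZ)) hϱ hϱA

end Slot

/-! ## §4 TERMS INDEXED BY COVERING FAMILIES: the count DISCHARGED by §2 from the (2.11)-geometry one scale down -/

section Families

variable {C : Carriers} {P : MeasPotFrame C} {Op : Type*} [NormedAddCommGroup Op] [NormedSpace ℂ Op] {Dk : LocDomainSys}
  {𝒴 : ℕ → Finset Dk.Dom → Type*} {dom : ∀ k i, 𝒴 k i → C.Dom} {β : ℕ → Finset Dk.Dom → Type*}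
  [∀ k i, MeasurableSpace (β k i)] {α : ℕ → Finset Dk.Dom → Type*} [∀ k i, NormedAddCommGroup (α k i)]
  [∀ k i, InnerProductSpace ℝ (α k i)] [∀ k i, FiniteDimensional ℝ (α k i)] [∀ k i, MeasurableSpace (α k i)]
  [∀ k i, BorelSpace (α k i)]
variable (D : LocDomainSys) {Cube : Type} [DecidableEq Cube] (G : Geometry D Cube) {CubeK : Type} [DecidableEq CubeK]
  (Gk : Geometry Dk CubeK)

open Classical in
/-- **THE ATTACHED PART FOR CORES INDEXED BY COVERING FAMILIES, (B3)'s COUNT DISCHARGED** (kernel; §3's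
`attachedPart_locE_le_of_coresAt_pencil_count` at the term index `Finset Dk.Dom` — one core `𝔊 k 𝐃 X` per Mayer subfamily `𝐃` of
scale-`k` domains — with the table-blind majorant `maj Z 𝐃 := Π_{Y∈𝐃} α₆ e^{−δκ d_k(Y)}·e^{−R(d_k(Y)+5)}` and `hCount` SUPPLIED by
§2's `count_coveringFamilies_geometry`: (2.29) from `B13FamilySum.ineq229_locDomainSys` on the cell's (2.11)-geometry `Gk` one
scale down ((1.26) `Gk.ineq126`, volume bound `Gk.volBound`), (2.27) `Gk.ineq227` with print's `5`, the `locE` polymer read as the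
scale-`k` domain `foot Z` (`hmono`, (2.36) KIND), print's order of choice `κ₀ + 1 ≤ δκ` ∕ `e K₀ c₁ α₆ ≤ 1`; `R ≥ 0` follows from
`hrate`).  What stays DISPLAYED of (B3): `hterms` (the terms of `Z` ARE covering families of `Gk.cubes (foot Z)` — (B1b) READING) and
the per-family AMPLITUDE `hAmp`: letters of the core for `𝐃` ≤ `(A₀ + ϱA₁)·Π_{Y∈𝐃} α₆ e^{−δκ d_k(Y)}·e^{−R(d_k(Y)+5)}` — print's
(2.15)∕(2.18) mechanism `2∕|τ(Y)| = 2E₀ε₁C₁α₄⁻¹M^q e^{C₂κ₁}·e^{−(1−3δ)κ d_k(Y)}` per polymer of `𝐃` together with `e^{N₁R₀}`, read at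
the DRESSED table radius `‖h₀‖ + ϱ‖w‖` (p. 18's clause `2E₀ε₁C₁α₄⁻¹α₆⁻¹M^q e^{C₂κ₁}e^{5κ} ≤ 1` KIND at the dressed level — NOT asserted). [folklore] -/
theorem attachedPart_locE_le_of_coresAt_pencil_families {W : Set (ℕ → ℝ)}
    {ctr : ℕ → (ℕ → ℝ) → C.BgB → Op × B13HistM P} {ROp RHist R' : ℕ → ℝ}
    (𝔊 : ∀ k i, C.Dom → BiCore P (dom k i) Op (β k i) (α k i)) {mq bq N₀ : ℕ → Finset Dk.Dom → C.Dom → ℝ}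
    (hroom : ∀ k, ROp k < R' k)
    (hm : ∀ k, ∀ g ∈ W, ∀ (U : C.BgB) (X : C.Dom), C.scale X = k → ∀ i, 0 < mq k i X)
    (hN : ∀ k, ∀ g ∈ W, ∀ (U : C.BgB) (X : C.Dom), C.scale X = k → ∀ i,
      (∀ o ∈ ball (ctr k g U).1 (R' k), AEStronglyMeasurable ((𝔊 k i X).N o) (𝔊 k i X).lam) ∧
      (∀ p, DifferentiableOn ℂ (fun o => (𝔊 k i X).N o p) (ball (ctr k g U).1 (R' k))) ∧
      (∀ o ∈ ball (ctr k g U).1 (R' k), ∀ p, ‖(𝔊 k i X).N o p‖ ≤ N₀ k i X))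
    (hq : ∀ k, ∀ g ∈ W, ∀ (U : C.BgB) (X : C.Dom), C.scale X = k → ∀ i,
      (∀ o ∈ ball (ctr k g U).1 (R' k),
        AEStronglyMeasurable (Function.uncurry ((𝔊 k i X).q o)) ((𝔊 k i X).lam.prod volume)) ∧
      (∀ p v, DifferentiableOn ℂ (fun o => (𝔊 k i X).q o p v) (ball (ctr k g U).1 (R' k))) ∧
      (∀ o ∈ ball (ctr k g U).1 (R' k), ∀ p v, mq k i X * ‖v‖ ^ 2 - bq k i X ≤ ((𝔊 k i X).q o p v).re))
    {k : ℕ} {g : ℕ → ℝ} (hg : g ∈ W) {U : C.BgB} {o : Op} {h₀ w : B13HistM P} {ϱ : ℝ}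
    (hO : ‖o - (ctr k g U).1‖ ≤ ROp k) (hH : ‖h₀ - (ctr k g U).2‖ + ϱ * ‖w‖ ≤ RHist k)
    {emb : D.Dom → C.Dom} (hscale : ∀ Z, C.scale (emb Z) = k) {terms : D.Dom → Finset (Finset Dk.Dom)}
    {act : ℂ → D.Dom → ℂ}
    (hact : ∀ s ∈ ball (0 : ℂ) ϱ, ∀ Z, act s Z = ∑ i ∈ terms Z, (𝔊 k i (emb Z)).termAt o (h₀ + s • w))
    {A₀ A₁ R r₁ b₅ : ℝ} {X₀ : D.Dom} (hA₀ : 0 ≤ A₀) (hA₁ : 0 ≤ A₁) (hr₁ : 0 ≤ r₁) (hb : r₁ * 5 ≤ b₅)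
    (hrate : r₁ + 2 * G.κ₀ + 2 ≤ R) (hsmall : (A₀ + ϱ * A₁) * Real.exp (b₅ + 1) * G.K₀ * G.ν * G.c₁ ≤ 1)
    (foot : D.Dom → Dk.Dom) (hmono : ∀ Z, D.dj Z ≤ Dk.dj (foot Z)) {δ κ α₆ : ℝ} (hα₆ : 0 ≤ α₆)
    (hκ : Gk.κ₀ + 1 ≤ δ * κ) (h229 : Real.exp 1 * Gk.K₀ * Gk.c₁ * α₆ ≤ 1)
    (hterms : ∀ Z, terms Z ⊆ coveringFamilies Finset.univ Gk.cubes (Gk.cubes (foot Z)))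
    (hAmp : ∀ Z, G.cubes Z ⊆ G.cubes X₀ → ∀ Df ∈ terms Z,
      (𝔊 k Df (emb Z)).lam.real univ * ((𝔊 k Df (emb Z)).wB * N₀ k Df (emb Z) * Real.exp (bq k Df (emb Z))) *
          (Real.pi / (mq k Df (emb Z) / 2)) ^ (Module.finrank ℝ (α k Df) / 2 : ℝ) *
        Real.exp ((𝔊 k Df (emb Z)).N₁ * (‖h₀‖ + ϱ * ‖w‖)) ≤
      (A₀ + ϱ * A₁) * ∏ Y ∈ Df, (α₆ * Real.exp (-(δ * κ * Dk.dj Y)) * Real.exp (-(R * (Dk.dj Y + 5)))))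
    (hϱ : 2 ≤ ϱ) (hϱA : A₀ ≤ ϱ * A₁) :
    ‖locE G.ι G.cubes (act 1) (G.cubes X₀) - locE G.ι G.cubes (act 0) (G.cubes X₀)‖ ≤
      4 * (Real.exp 1 * G.ν * G.c₁ * G.K₀ ^ 2) * A₁ * Real.exp (-(r₁ * D.dj X₀)) :=
  have hR : 0 ≤ R := by linarith [G.κ₀_nonneg]
  attachedPart_locE_le_of_coresAt_pencil_count D G 𝔊 hroom hm hN hq hg hO hH hscale hact hA₀ hA₁ hr₁ hb hrate hsmall
    (fun _ Df => ∏ Y ∈ Df, (α₆ * Real.exp (-(δ * κ * Dk.dj Y)) * Real.exp (-(R * (Dk.dj Y + 5))))) hAmp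
    (fun Z _ => count_coveringFamilies_geometry Gk foot hmono hα₆ hκ h229 hR Z (hterms Z)) hϱ hϱA

end Families

end Summit.QuantumFields.BalabanUV.T4Continuum.NE1p.DressedSmallFieldFamilyCount

end
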